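import Literature.MathematicalPhysics.QuantumLattice.InfVolFermionStateTorusLimitTwoSectorReverseRow
import Literature.MathematicalPhysics.QuantumLattice.TorusLimitOfMixturesCompactness
import HarnessLib

/-!
# Companion data of the two-sector (canonical chemical potential) rows EXIST for every thermal torus
# limit — no bracket hypothesis

Topic `Literature/MathematicalPhysics/QuantumLattice`; complement of
`InfVolFermionStateTorusLimitTwoSectorCompanion.lean`. There, `exists_twoSector_companion_of_sectorGibbs`
produces the joint data `(φ, ω', r)` of the two-sector energy–entropy balance rows (a companion torus limit
`ω'` of the image-sector canonical states along a subsequence `Ls ∘ φ` and the limit `r` of the ratio of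
canonical partition functions) GIVEN an a-priori bracket `r_L ∈ [c₁, c₂]` eventually — an input the tree
did not supply. This file removes the input:

* §2 `IsTorusLimitOfMixture.exists_twoSector_companion_of_pos_moments` (abstract two-sector form: sector
  families `P_L`, `P'_L` invariant under `H_L` and the translations, canonical eigen-data in any
  presentation, a local generator `A` whose torus embedding carries `P_L → P'_L` with adjoint carrying
  `P'_L → P_L` eventually). If the `x`-moment `Re ω_{Λ₁}(ÃᴴÃ)` is `> 0` and the `y'`-moment `Re ω'_{Λ₁}(ÃÃᴴ)`
  is `> 0` for EVERY candidate companion `ω'` (torus limit of the `P'`-mixtures along a subsequence), then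
  joint data `(φ, ω', r)` exist with `r > 0`. Mechanism: weak-⋆ compactness for `ω'`
  (`InfVolFermionState.exists_isTorusLimitOfMixture_subseq`); Bolzano–Weierstrass for the COMPACTIFIED
  ratio `u_j = r_j/(1 + r_j) ∈ [0, 1]`; `u = 0` would make the rows of `A`
  (`InfVolFermionState.re_expect_twoSector_eeb_nonneg_of_canonical_limits_eventually` with `r = 0`) read
  `0 ≤ βh − s·x` for all `s`, impossible for `x > 0` (`not_forall_linear_rows_zero`); `u = 1` would do the
  same to the rows of `Aᴴ` from `P'` back to `P` (inverse ratio `→ 0`, `y' > 0`); hence `0 < u < 1` and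
  `r_j → u/(1 − u) > 0`.
* §3 `IsTorusLimitOfMixture.exists_twoSector_predCompanion_of_sectorGibbs` — the «rm↑» instance for the
  thermal object of record (torus limits of the canonical `(rectN n L, S^z = 0)` Gibbs states, `0 < n < 2`,
  image sectors `(k_L − 1, k_L)`): the `x`-moment of `c_{0↑}` is the density `n/2 > 0`
  (`…re_expect_nAt_eq_half_of_sectorGibbs`) and its `y'`-moment in any companion is the hole density
  `1 − n/2 > 0` (`…re_expect_nAt_up_eq_half_of_predCompanion`), so the joint data consumed by
  `…re_expect_twoSector_eeb_annihilation_up_nonneg_of_sectorGibbs` and by the reversed row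
  `…creation_up_reverse_nonneg_of_sectorGibbs` exist for EVERY such `ω`, with `r > 0`.

CONSEQUENCE FOR READERS: a certificate proved for all admissible `(ω', r)` of the two-sector rows (one
moment vector per image sector, one scanned parameter `r` per charge) is a statement about every thermal
torus limit `ω` of record — no bracket, no nonemptiness, no mapping hypothesis is left open for the
single-site templates. HONEST SCOPE: existence along a subsequence; no uniqueness of `ω'` or `r`; no claim
`ω' = ω` (that would be equivalence of ensembles). Everything is PROVED; no definition, no named fact.

## Mathlib / tree search

REUSED: `InfVolFermionState.exists_isTorusLimitOfMixture_subseq`, `IsTorusLimitOfMixture.comp_tendsto`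
(`TorusLimitOfMixturesCompactness`); `InfVolFermionState.re_expect_twoSector_eeb_nonneg_of_canonical_limits_eventually`,
`annihilation_up_mulVec_mem_szSector_pred`, `creation_up_mulVec_mem_szSector_rectN`,
`fermionEmbed_toTorusEmb_incl_annihilation` (`…TwoSectorSingleAnnihilator`); the density / moment lemmas and
`sectorGibbsWeightTT'_eq_canonicalWeight`, `eventually_one_le_halfRectN_comp`, `halfRectN_le_mul_self`
(`…TwoSectorReverseRow`); `exists_spinConfig_of_le` (`…TwoSectorCompanion`), `exists_szConfig`;
Mathlib `tendsto_subseq_of_bounded`, `Metric.isBounded_Icc`, `isClosed_Icc`, `Filter.Tendsto.div`,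
`Filter.tendsto_add_atTop_nat`, `StrictMono.tendsto_atTop`, `Tendsto.eventually`.
`lean search 'pos_moments|predCompanion|div_one_add_mem_Icc'`: nothing relevant (2026-08-27).

## References

* O. Bratteli, D. W. Robinson, *Operator Algebras and Quantum Statistical Mechanics 1* (1987),
  Thm. 2.3.15 (weak-⋆ compactness of the state space), §4.3.1.
  [cite: BratteliRobinsonI1987, Thm. 2.3.15 (weak-⋆ compactness of the state space) and §4.3.1]
* O. Bratteli, D. W. Robinson, *Operator Algebras and Quantum Statistical Mechanics 2* (1997), Thm. 5.3.15
  (Araki–Sewell; the function `x log(x/y)`), §5.4.2 (chemical potential as the free-energy cost of a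
  charge). [cite: BratteliRobinsonII1997, §5.4.2]
* H. Fawzi, O. Fawzi, S. O. Scalet (2024), Thm. 3.1 (linearised EEB rows). [cite: FawziFawziScalet2024, Thm. 3.1]
* R. B. Israel, *Convexity in the Theory of Lattice Gases* (1979), §I.3 eq. (26). [cite: Israel1979, §I.3 eq. (26)]
* E. H. Lieb, Phys. Rev. Lett. 62 (1989) 1201, proof of Thm. 1 (`c_{xσ}` between spin sectors).
  [cite: LiebPRL1989, proof of Theorem 1]
-/

noncomputable section

namespace Literature.MathematicalPhysics.QuantumLattice

open Matrix Finset HubbardWave0 Literature.Probability.LatticeModels ThermodynamicLimit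
open _root_.Filter
open scoped _root_.Topology ComplexOrder BigOperators

/-! ### §1 Real-variable lemmas: rows with a vanishing fugacity term; the compactification `r/(1+r)` -/

section Real

/-- **Linear rows with a vanishing fugacity term are inconsistent with a positive density**: there is no
real `a` with `0 ≤ a − s·x + q·0·y` for all `e^{s−1} ≤ q` when `x > 0` (take `s = a/x + 1`): the
Araki–Sewell function `x log(x/(r y))` is `+∞` at `r = 0`. [cite: BratteliRobinsonII1997, Thm. 5.3.15] -/
theorem not_forall_linear_rows_zero {x y a : ℝ} (hx : 0 < x)
    (hrows : ∀ s q : ℝ, Real.exp (s - 1) ≤ q → 0 ≤ a - s * x + q * 0 * y) : False := by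
  have h := hrows (a / x + 1) (Real.exp (a / x + 1 - 1)) le_rfl
  rw [mul_zero, zero_mul, add_zero] at h
  have : (a / x + 1) * x = a + x := by field_simp
  linarith

/-- The compactified ratio `u = r/(1+r)` inverts to `r = u/(1−u)` (`0 ≤ r`). [folklore] -/
private theorem div_one_add_div_one_sub {r : ℝ} (hr : 0 ≤ r) : r / (1 + r) / (1 - r / (1 + r)) = r := by
  have h1 : (1 + r) ≠ 0 := by positivity
  have h2 : 1 - r / (1 + r) = 1 / (1 + r) := by field_simp; ring
  rw [h2]
  field_simp

/-- … and `r⁻¹ = (1 − u)/u` (`0 < r`). [folklore] -/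
private theorem one_sub_div_one_add_div {r : ℝ} (hr : 0 < r) : (1 - r / (1 + r)) / (r / (1 + r)) = r⁻¹ := by
  have h1 : (1 + r) ≠ 0 := by positivity
  have h2 : 1 - r / (1 + r) = 1 / (1 + r) := by field_simp; ring
  rw [h2]
  field_simp

/-- `0 ≤ r/(1+r) ≤ 1` for `0 ≤ r`. [folklore] -/
private theorem div_one_add_mem_Icc {r : ℝ} (hr : 0 ≤ r) : r / (1 + r) ∈ Set.Icc (0 : ℝ) 1 :=
  ⟨div_nonneg hr (by positivity), (div_le_one (by positivity)).2 (by linarith)⟩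

/-- If `r_j/(1+r_j) → u < 1` then `r_j → u/(1−u)` (`r_j ≥ 0`). [folklore] -/
private theorem tendsto_of_tendsto_div_one_add {r : ℕ → ℝ} (hr : ∀ j, 0 ≤ r j) {u : ℝ} (hu1 : u < 1)
    (hu : Tendsto (fun j => r j / (1 + r j)) atTop (𝓝 u)) :
    Tendsto r atTop (𝓝 (u / (1 - u))) := by
  have h : Tendsto (fun j => r j / (1 + r j) / (1 - r j / (1 + r j))) atTop (𝓝 (u / (1 - u))) :=
    hu.div (tendsto_const_nhds.sub hu) (by linarith)
  exact h.congr fun j => div_one_add_div_one_sub (hr j)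

/-- If `r_j/(1+r_j) → 1` then `r_j⁻¹ → 0` (`r_j > 0`). [folklore] -/
private theorem tendsto_inv_of_tendsto_div_one_add {r : ℕ → ℝ} (hr : ∀ j, 0 < r j)
    (hu : Tendsto (fun j => r j / (1 + r j)) atTop (𝓝 1)) :
    Tendsto (fun j => (r j)⁻¹) atTop (𝓝 0) := by
  have h : Tendsto (fun j => (1 - r j / (1 + r j)) / (r j / (1 + r j))) atTop (𝓝 ((1 - 1) / 1)) :=
    (tendsto_const_nhds.sub hu).div hu one_ne_zero
  rw [sub_self, zero_div] at h
  exact h.congr fun j => one_sub_div_one_add_div (hr j)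

end Real

/-! ### §2 The abstract existence theorem: two sector families, a local generator with positive `x`- and
`y'`-moments -/

section Core

variable (t t' U β : ℝ)

/-- The sum of the canonical weights over an enumeration of a nonempty sector is `1`. [cite: Israel1979, §I.3 eq. (26)] -/
theorem sum_canonicalWeight_comp_equiv_eq_one {L : ℕ} {P : Finset (Orb (FermionTorus 2 L)) → Prop}
    [DecidablePred P] [Nonempty (Subtype P)] {m : ℕ} (e : Fin m ≃ Subtype P) {p : Fin m → ℝ}
    (hp : ∀ i, p i = canonicalWeight β (sectorEigenvalue P (hubbardTorusTT' L t t' U)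
      (hubbardTorusTT'_isHermitian L t t' U)) (e i)) :
    ∑ i, p i = 1 := by
  simp_rw [hp]
  rw [Equiv.sum_comp e (fun c => canonicalWeight β (sectorEigenvalue P (hubbardTorusTT' L t t' U)
    (hubbardTorusTT'_isHermitian L t t' U)) c)]
  exact sum_canonicalWeight β _

/-- **Companion data exist whenever the generator's `x`-moment in `ω` and its `y'`-moment in every
candidate companion are positive (abstract two-sector form).** Let `P_L`, `P'_L` be spin-sector families
of the `t–t'` torus (no matrix elements of `H_L` or of the translations leave them), with canonical
eigen-data presented as `(m, p, ψ, e)` and `(m', p', ψ', e')`; let `ω` be a torus limit of the `P`-mixtures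
along `Ls → ∞`, both families eventually nonempty; let `A ∈ 𝔄_Λ` be a local generator whose torus embedding
(eventually) carries `P_L` into `P'_L` and whose adjoint carries `P'_L` back. If `Re ω_{Λ₁}(ÃᴴÃ) > 0` and
`Re ω'_{Λ₁}(ÃÃᴴ) > 0` for EVERY torus limit `ω'` of the `P'`-mixtures along a subsequence of `Ls`, then
there are a strictly increasing `φ`, a state `ω'` and `r > 0` with: `ω` the torus limit of the `P`-mixtures
along `Ls ∘ φ`, `ω'` the torus limit of the `P'`-mixtures along `Ls ∘ φ`, and
`Z_{P'}(Ls (φ j))/Z_P(Ls (φ j)) → r`. Proof: weak-⋆ compactness for `ω'`; Bolzano–Weierstrass for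
`u_j = r_j/(1+r_j) ∈ [0,1]`; `u = 0` contradicts the rows of `A` (fugacity term `→ 0`, `x`-moment `> 0`),
`u = 1` contradicts the rows of `Aᴴ` from `P'` back to `P` (inverse ratio `→ 0`, `y'`-moment `> 0`).
[cite: BratteliRobinsonI1987, Thm. 2.3.15 (weak-⋆ compactness of the state space) and §4.3.1]
[cite: BratteliRobinsonII1997, §5.4.2] [cite: FawziFawziScalet2024, Thm. 3.1] -/
theorem InfVolFermionState.IsTorusLimitOfMixture.exists_twoSector_companion_of_pos_moments
    (P P' : ∀ L : ℕ, Finset (Orb (FermionTorus 2 L)) → Prop)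
    [hdP : ∀ L, DecidablePred (P L)] [hdP' : ∀ L, DecidablePred (P' L)]
    (hP : ∀ L s s', ¬ P L s → P L s' → hubbardTorusTT' L t t' U s s' = 0)
    (hP' : ∀ L s s', ¬ P' L s → P' L s' → hubbardTorusTT' L t t' U s s' = 0)
    (hUP : ∀ (L : ℕ) [NeZero L] (v : TorusSite 2 L) s s', ¬ P L s → P L s' → (fockTranslate v).val s s' = 0)
    (hUP' : ∀ (L : ℕ) [NeZero L] (v : TorusSite 2 L) s s', ¬ P' L s → P' L s' → (fockTranslate v).val s s' = 0)
    {m m' : ℕ → ℕ} {p : ∀ L, Fin (m L) → ℝ} {ψ : ∀ L, Fin (m L) → Fock (Orb (FermionTorus 2 L))}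
    {p' : ∀ L, Fin (m' L) → ℝ} {ψ' : ∀ L, Fin (m' L) → Fock (Orb (FermionTorus 2 L))}
    (e : ∀ L, Fin (m L) ≃ Subtype (P L)) (e' : ∀ L, Fin (m' L) ≃ Subtype (P' L))
    (hp : ∀ L i, p L i = canonicalWeight β (sectorEigenvalue (P L) (hubbardTorusTT' L t t' U)
      (hubbardTorusTT'_isHermitian L t t' U)) (e L i))
    (hψ : ∀ L i, ψ L i = sectorEigenvector (P L) (hubbardTorusTT' L t t' U)
      (hubbardTorusTT'_isHermitian L t t' U) (e L i))
    (hp' : ∀ L i, p' L i = canonicalWeight β (sectorEigenvalue (P' L) (hubbardTorusTT' L t t' U)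
      (hubbardTorusTT'_isHermitian L t t' U)) (e' L i))
    (hψ' : ∀ L i, ψ' L i = sectorEigenvector (P' L) (hubbardTorusTT' L t t' U)
      (hubbardTorusTT'_isHermitian L t t' U) (e' L i))
    {Ls : ℕ → ℕ} (hLs : Tendsto Ls atTop atTop) {ω : InfVolFermionState 2}
    (hω : ω.IsTorusLimitOfMixture m p ψ Ls)
    (hne : ∀ᶠ j in atTop, Nonempty (Subtype (P (Ls j))))
    (hne' : ∀ᶠ j in atTop, Nonempty (Subtype (P' (Ls j))))
    {Λ : Finset (Site 2)} (A : FermionOp Λ)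
    (hB : ∀ᶠ j in atTop, ∀ (hL : NeZero (Ls j)) (h₁ : Set.InjOn (Torus.proj (d := 2) (Ls j)) ↑(thicken Λ 1)) s s',
      ¬ P' (Ls j) s → P (Ls j) s' →
        fermionEmbed (@PolySite.toTorusEmb 2 (Ls j) hL _ h₁)
          (fermionEmbed (PolySite.incl (subset_thicken Λ 1)) A) s s' = 0)
    (hB' : ∀ᶠ j in atTop, ∀ (hL : NeZero (Ls j)) (h₁ : Set.InjOn (Torus.proj (d := 2) (Ls j)) ↑(thicken Λ 1)) s s',
      ¬ P (Ls j) s → P' (Ls j) s' →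
        (fermionEmbed (@PolySite.toTorusEmb 2 (Ls j) hL _ h₁)
          (fermionEmbed (PolySite.incl (subset_thicken Λ 1)) A))ᴴ s s' = 0)
    (hx : 0 < (ω.expect (thicken Λ 1)
      ((fermionEmbed (PolySite.incl (subset_thicken Λ 1)) A)ᴴ * fermionEmbed (PolySite.incl (subset_thicken Λ 1)) A)).re)
    (hy : ∀ (φ : ℕ → ℕ) (ω' : InfVolFermionState 2), StrictMono φ →
      ω'.IsTorusLimitOfMixture m' p' ψ' (Ls ∘ φ) →
        0 < (ω'.expect (thicken Λ 1)
          (fermionEmbed (PolySite.incl (subset_thicken Λ 1)) A * (fermionEmbed (PolySite.incl (subset_thicken Λ 1)) A)ᴴ)).re) :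
    ∃ φ : ℕ → ℕ, StrictMono φ ∧ ∃ ω' : InfVolFermionState 2, ∃ r : ℝ, 0 < r ∧
      ω.IsTorusLimitOfMixture m p ψ (Ls ∘ φ) ∧ ω'.IsTorusLimitOfMixture m' p' ψ' (Ls ∘ φ) ∧
      Tendsto (fun j =>
        (∑ d, Real.exp (-(β * sectorEigenvalue (P' (Ls (φ j))) (hubbardTorusTT' (Ls (φ j)) t t' U)
            (hubbardTorusTT'_isHermitian (Ls (φ j)) t t' U) d))) /
          ∑ c, Real.exp (-(β * sectorEigenvalue (P (Ls (φ j))) (hubbardTorusTT' (Ls (φ j)) t t' U)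
            (hubbardTorusTT'_isHermitian (Ls (φ j)) t t' U) c))) atTop (𝓝 r) := by
  classical
  -- the ratio as a function of the side
  set R : ℕ → ℝ := fun L =>
    (∑ d, Real.exp (-(β * sectorEigenvalue (P' L) (hubbardTorusTT' L t t' U)
        (hubbardTorusTT'_isHermitian L t t' U) d))) /
      ∑ c, Real.exp (-(β * sectorEigenvalue (P L) (hubbardTorusTT' L t t' U)
        (hubbardTorusTT'_isHermitian L t t' U) c)) with hR
  -- a tail on which both sectors are nonempty
  obtain ⟨j₀, hj₀⟩ := eventually_atTop.1 (hne.and hne')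
  set Ls₁ : ℕ → ℕ := fun j => Ls (j + j₀) with hLs₁
  have hLs₁' : Tendsto Ls₁ atTop atTop := hLs.comp (tendsto_add_atTop_nat j₀)
  have hRpos : ∀ j, 0 < R (Ls₁ j) := fun j => by
    haveI := (hj₀ (j + j₀) (Nat.le_add_left _ _)).1
    haveI := (hj₀ (j + j₀) (Nat.le_add_left _ _)).2
    exact div_pos (Finset.sum_pos (fun _ _ => Real.exp_pos _) Finset.univ_nonempty)
      (Finset.sum_pos (fun _ _ => Real.exp_pos _) Finset.univ_nonempty)
  -- Step 1: a companion state along a subsequence of the tail, by weak-⋆ compactness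
  have hp0 : ∀ j i, 0 ≤ p' (Ls₁ j) i := fun j i => by
    rw [hp']
    exact canonicalWeight_nonneg β _ _
  have hp1 : ∀ j, ∑ i, p' (Ls₁ j) i = 1 := fun j => by
    haveI := (hj₀ (j + j₀) (Nat.le_add_left _ _)).2
    exact sum_canonicalWeight_comp_equiv_eq_one t t' U β (e' (Ls₁ j)) (hp' (Ls₁ j))
  have hψ1 : ∀ j i, star (ψ' (Ls₁ j) i) ⬝ᵥ ψ' (Ls₁ j) i = 1 := fun j i => by
    rw [hψ']
    exact star_sectorEigenvector_dotProduct_self _ _ _ _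
  obtain ⟨φ₁, hφ₁, ω', hω'⟩ := InfVolFermionState.exists_isTorusLimitOfMixture_subseq p' ψ' hLs₁' hp0 hp1 hψ1
  -- Step 2: Bolzano–Weierstrass for the compactified ratio `u = R/(1+R) ∈ [0,1]`
  have humem : ∀ j, R (Ls₁ (φ₁ j)) / (1 + R (Ls₁ (φ₁ j))) ∈ Set.Icc (0 : ℝ) 1 := fun j =>
    div_one_add_mem_Icc (hRpos _).le
  obtain ⟨u, hu, φ₂, hφ₂, hlim⟩ := tendsto_subseq_of_bounded (Metric.isBounded_Icc 0 1) humem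
  rw [isClosed_Icc.closure_eq] at hu
  -- the common subsequence
  set φ : ℕ → ℕ := fun j => φ₁ (φ₂ j) + j₀ with hφdef
  have hφ : StrictMono φ := fun i j hij => Nat.add_lt_add_right (hφ₁ (hφ₂ hij)) j₀
  have hLsφ : Tendsto (Ls ∘ φ) atTop atTop := hLs.comp hφ.tendsto_atTop
  have hωφ : ω.IsTorusLimitOfMixture m p ψ (Ls ∘ φ) := hω.comp_tendsto hφ.tendsto_atTop
  have hω'φ : ω'.IsTorusLimitOfMixture m' p' ψ' (Ls ∘ φ) := hω'.comp_tendsto hφ₂.tendsto_atTop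
  have hRposφ : ∀ j, 0 < R (Ls (φ j)) := fun j => hRpos (φ₁ (φ₂ j))
  have hlim' : Tendsto (fun j => R (Ls (φ j)) / (1 + R (Ls (φ j)))) atTop (𝓝 u) := hlim
  have hBφ := hφ.tendsto_atTop.eventually hB
  have hB'φ := hφ.tendsto_atTop.eventually hB'
  -- Step 3: `u ≠ 0` — the rows of `A` with a vanishing fugacity term contradict `x > 0`
  have hu0 : u ≠ 0 := by
    rintro rfl
    have hr0 : Tendsto (fun j => R (Ls (φ j))) atTop (𝓝 0) := by
      have h := tendsto_of_tendsto_div_one_add (fun j => (hRposφ j).le) zero_lt_one hlim'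
      rwa [zero_div] at h
    exact not_forall_linear_rows_zero hx fun s q hq =>
      InfVolFermionState.re_expect_twoSector_eeb_nonneg_of_canonical_limits_eventually t t' U β P P' hP hP'
        hUP hUP' e e' hp hψ hp' hψ' hLsφ hωφ hω'φ hr0 A hBφ hB'φ hq
  -- Step 4: `u ≠ 1` — the rows of `Aᴴ` from `P'` back to `P` (inverse ratio `→ 0`) contradict `y' > 0`
  have hu1 : u ≠ 1 := by
    rintro rfl
    have hr0 : Tendsto (fun j =>
        (∑ c, Real.exp (-(β * sectorEigenvalue (P (Ls (φ j))) (hubbardTorusTT' (Ls (φ j)) t t' U)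
            (hubbardTorusTT'_isHermitian (Ls (φ j)) t t' U) c))) /
          ∑ d, Real.exp (-(β * sectorEigenvalue (P' (Ls (φ j))) (hubbardTorusTT' (Ls (φ j)) t t' U)
            (hubbardTorusTT'_isHermitian (Ls (φ j)) t t' U) d))) atTop (𝓝 0) := by
      have h := tendsto_inv_of_tendsto_div_one_add hRposφ hlim'
      refine h.congr fun j => ?_
      rw [hR, inv_div]
    have hBa : ∀ᶠ j in atTop, ∀ (hL : NeZero (Ls (φ j)))
        (h₁ : Set.InjOn (Torus.proj (d := 2) (Ls (φ j))) ↑(thicken Λ 1)) s s',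
        ¬ P (Ls (φ j)) s → P' (Ls (φ j)) s' →
          fermionEmbed (@PolySite.toTorusEmb 2 (Ls (φ j)) hL _ h₁)
            (fermionEmbed (PolySite.incl (subset_thicken Λ 1)) Aᴴ) s s' = 0 := by
      filter_upwards [hB'φ] with j hj hL h₁ s s' hs hs'
      rw [fermionEmbed_conjTranspose, fermionEmbed_conjTranspose]
      exact hj hL h₁ s s' hs hs'
    have hBa' : ∀ᶠ j in atTop, ∀ (hL : NeZero (Ls (φ j)))
        (h₁ : Set.InjOn (Torus.proj (d := 2) (Ls (φ j))) ↑(thicken Λ 1)) s s',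
        ¬ P' (Ls (φ j)) s → P (Ls (φ j)) s' →
          (fermionEmbed (@PolySite.toTorusEmb 2 (Ls (φ j)) hL _ h₁)
            (fermionEmbed (PolySite.incl (subset_thicken Λ 1)) Aᴴ))ᴴ s s' = 0 := by
      filter_upwards [hBφ] with j hj hL h₁ s s' hs hs'
      rw [fermionEmbed_conjTranspose, fermionEmbed_conjTranspose, conjTranspose_conjTranspose]
      exact hj hL h₁ s s' hs hs'
    exact not_forall_linear_rows_zero (hy φ ω' hφ hω'φ) fun s q hq => by
      have h := InfVolFermionState.re_expect_twoSector_eeb_nonneg_of_canonical_limits_eventually t t' U β P' P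
        hP' hP hUP' hUP e' e hp' hψ' hp hψ hLsφ hω'φ hωφ hr0 Aᴴ hBa hBa' hq
      rw [fermionEmbed_conjTranspose, conjTranspose_conjTranspose] at h
      exact h
  -- Step 5: assemble with `r = u/(1−u) > 0`
  have hu0' : 0 < u := lt_of_le_of_ne hu.1 (Ne.symm hu0)
  have hu1' : u < 1 := lt_of_le_of_ne hu.2 hu1
  exact ⟨φ, hφ, ω', u / (1 - u), div_pos hu0' (by linarith), hωφ, hω'φ,
    tendsto_of_tendsto_div_one_add (fun j => (hRposφ j).le) hu1' hlim'⟩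

end Core

/-! ### §3 The «rm↑» companion of the thermal object of record: image sectors `(k_L − 1, k_L)` -/

section Record

variable (t t' U β : ℝ)

/-- **The joint data of the «rm↑» rows exist, hypothesis-free.** Let `ω` be a torus limit of the
canonical Gibbs states of `hubbardTorusTT' (Ls j) t t' U` at inverse temperature `β` on the sectors
`(rectN n (Ls j), S^z = 0)` along `Ls → ∞`, with `0 < n < 2`. Then there are a strictly increasing `φ`, a
state `ω'` and a real `r > 0` such that: `ω` is (still) the torus limit of the object of record along
`Ls ∘ φ`; `ω'` is the torus limit along `Ls ∘ φ` of the canonical eigen-mixtures of the image spin sectors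
`(k_L − 1, k_L)` (`k_L = halfRectN n L`); and `Z_{(k−1,k)}(Ls (φ j))/Z_{(k,k)}(Ls (φ j)) → r` — exactly the
hypotheses of `IsTorusLimitOfMixture.re_expect_twoSector_eeb_annihilation_up_nonneg_of_sectorGibbs` and of
the reversed row, with NO bracket on the ratio assumed (the `x`-moment of `c_{0↑}` is `n/2 > 0` in `ω`, its
`y'`-moment is `1 − n/2 > 0` in every candidate companion). Consequently a certificate valid for all
admissible `(ω', r)` is a statement about EVERY thermal torus limit `ω`.
[cite: BratteliRobinsonI1987, Thm. 2.3.15 (weak-⋆ compactness of the state space) and §4.3.1]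
[cite: BratteliRobinsonII1997, §5.4.2] [cite: FawziFawziScalet2024, Thm. 3.1] -/
theorem InfVolFermionState.IsTorusLimitOfMixture.exists_twoSector_predCompanion_of_sectorGibbs
    {n : ℝ} (hn0 : 0 < n) (hn2 : n < 2) {Ls : ℕ → ℕ} (hLs : Tendsto Ls atTop atTop)
    {ω : InfVolFermionState 2}
    (hω : ω.IsTorusLimitOfMixture (sectorGibbsCount n) (fun L => sectorGibbsWeightTT' β t t' U n L)
      (fun L => sectorGibbsVectorTT' t t' U n L) Ls) :
    ∃ φ : ℕ → ℕ, StrictMono φ ∧ ∃ ω' : InfVolFermionState 2, ∃ r : ℝ, 0 < r ∧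
      ω.IsTorusLimitOfMixture (sectorGibbsCount n) (fun L => sectorGibbsWeightTT' β t t' U n L)
        (fun L => sectorGibbsVectorTT' t t' U n L) (Ls ∘ φ) ∧
      ω'.IsTorusLimitOfMixture
        (fun L => Fintype.card (Subtype (spinConfig (Λ := FermionTorus 2 L) (halfRectN n L - 1) (halfRectN n L))))
        (fun L i => canonicalWeight β (sectorEigenvalue (spinConfig (halfRectN n L - 1) (halfRectN n L))
          (hubbardTorusTT' L t t' U) (hubbardTorusTT'_isHermitian L t t' U)) ((Fintype.equivFin _).symm i))
        (fun L i => sectorEigenvector (spinConfig (halfRectN n L - 1) (halfRectN n L)) (hubbardTorusTT' L t t' U)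
          (hubbardTorusTT'_isHermitian L t t' U) ((Fintype.equivFin _).symm i)) (Ls ∘ φ) ∧
      Tendsto (fun j =>
        (∑ d, Real.exp (-(β * sectorEigenvalue (spinConfig (halfRectN n (Ls (φ j)) - 1) (halfRectN n (Ls (φ j))))
            (hubbardTorusTT' (Ls (φ j)) t t' U) (hubbardTorusTT'_isHermitian (Ls (φ j)) t t' U) d))) /
          (∑ c, Real.exp (-(β * sectorEigenvalue (szConfig n (Ls (φ j))) (hubbardTorusTT' (Ls (φ j)) t t' U)
            (hubbardTorusTT'_isHermitian (Ls (φ j)) t t' U) c)))) atTop (𝓝 r) := by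
  have hn0' : 0 ≤ n := hn0.le
  have hn2' : n ≤ 2 := hn2.le
  refine hω.exists_twoSector_companion_of_pos_moments t t' U β
    (fun L => szConfig n L) (fun L => spinConfig (Λ := FermionTorus 2 L) (halfRectN n L - 1) (halfRectN n L))
    (fun L s s' hs hs' => hubbardTorusTT'_apply_eq_zero_of_szConfig L t t' U n s s' hs hs')
    (fun L s s' hs hs' => hubbardTorusTT'_apply_eq_zero_of_spinConfig L t t' U _ _ s s' hs hs')
    (fun L _ v s s' hs hs' => fockTranslate_apply_eq_zero_of_szConfig L v n s s' hs hs')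
    (fun L _ v s s' hs hs' => fockTranslate_apply_eq_zero_of_spinConfig L v _ _ s s' hs hs')
    (fun L => sectorGibbsIndex n L) (fun L => (Fintype.equivFin _).symm)
    (sectorGibbsWeightTT'_eq_canonicalWeight t t' U β n) (fun L i => rfl) (fun L i => rfl) (fun L i => rfl) hLs
    (Eventually.of_forall fun j => ?_) (Eventually.of_forall fun j => ?_)
    (Λ := {0}) (annihilation (orb (PolySite.pt (0 : Site 2) (Finset.mem_singleton_self 0)) 0)) ?_ ?_ ?_ ?_
  · obtain ⟨s, hs⟩ := exists_szConfig hn0' hn2' (Ls j)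
    exact ⟨⟨s, hs⟩⟩
  · obtain ⟨s, hs⟩ := exists_spinConfig_of_le (Ls j)
      ((Nat.sub_le _ _).trans (halfRectN_le_mul_self hn0' hn2' (Ls j))) (halfRectN_le_mul_self hn0' hn2' (Ls j))
    exact ⟨⟨s, hs⟩⟩
  · filter_upwards [eventually_one_le_halfRectN_comp hn0 hLs] with j hk hL h₁ s s' hs hs'
    rw [fermionEmbed_toTorusEmb_incl_annihilation]
    exact apply_eq_zero_off_of_mulVec_mem₂ (szConfig n (Ls j)) (spinConfig _ _)
      (szSector (rectN n (Ls j)) 0) (szSector _ _) (mem_szSector_rectN_iff n (Ls j))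
      (mem_szSector_iff_spinConfig (Ls j) _ _)
      (fun w hw => annihilation_up_mulVec_mem_szSector_pred (Ls j) hk _ w hw) s s' hs hs'
  · filter_upwards [eventually_one_le_halfRectN_comp hn0 hLs] with j hk hL h₁ s s' hs hs'
    rw [fermionEmbed_toTorusEmb_incl_annihilation]
    exact apply_eq_zero_off_of_mulVec_mem₂ (spinConfig _ _) (szConfig n (Ls j))
      (szSector _ _) (szSector (rectN n (Ls j)) 0) (mem_szSector_iff_spinConfig (Ls j) _ _)
      (mem_szSector_rectN_iff n (Ls j))
      (fun w hw => creation_up_mulVec_mem_szSector_rectN (Ls j) hk _ w hw) s s' hs hs'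
  · rw [hω.isTranslationInvariant.expect_conjTranspose_mul_fermionEmbed_incl_cAt,
      hω.re_expect_nAt_eq_half_of_sectorGibbs t t' U β hn0' hn2' hLs 0]
    exact half_pos hn0
  · intro φ ω' hφ hω'
    rw [hω'.isTranslationInvariant.expect_fermionEmbed_incl_cAt_mul_conjTranspose, Complex.sub_re, Complex.one_re,
      hω'.re_expect_nAt_up_eq_half_of_predCompanion t t' U β hn0' hn2' (hLs.comp hφ.tendsto_atTop)]
    linarith

end Record

end Literature.MathematicalPhysics.QuantumLattice

end
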